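import Summits.AtomisticToContinuum.FouriersLaw.Theorems.OddSectorIrreversibilitySubBallisticWindowPartial
import Literature.MathematicalPhysics.KineticTheory.ChainReflection

/-!
# `SubBallisticWindow` (stmt-AtomisticToContinuum-14070), line `Sketch`: the saturation envelope and the late windows

Support file for crux `Summit.AtomisticToContinuum.FouriersLaw.Theses.OddSectorIrreversibility.SubBallisticWindow`
(E2 of route OddSectorIrreversibility), line `Sketch` (coboundary–Thomson ceiling). Notation as in
`…SubBallisticWindowPartial`: closed pinned anharmonic chain `pinnedChain ω₂ lam β γ` (`ω₂ > 0`, `lam, β ≥ 0`, any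
`γ`, `T > 0`), `μ_T = e^{-H/T} dq dp` of mass `Z`, block `B = [k₁,k₂)` of length `ℓ = k₂ - k₁` with `k₂ + 1 ≤ N`,
`V_B(τ) = ∫ (∫_{(0,τ]} J_B(Φ_t x) dt)² dμ_T(x)`.

The two PLATEAU correctors.  The weighted site energies `W_w = ∑_k w_k h_k` (`Negative.ClosedFlow.weightedEnergy`)
with the right plateau `w_k = min(k,k₂) ∸ k₁` (`k < N`; support `(k₁, N)`) and with the left plateau
`w_k = (min(k,k₂) ∸ k₁) - ℓ` (support `[0, k₂)`) both satisfy `{H, W_w} = J_B` EXACTLY (the discrete gradient of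
either weight is the indicator of the block; the right plateau's jump at the last site multiplies `j_{N-1} ≡ 0`), so
in the Thomson inequality (`…CoboundaryCeiling.stub_coboundaryCeiling`) the defect term vanishes and
`V_B(τ) ≤ 8 Var_{μ_T}(W_w)` for EVERY window `τ ≥ 0`; the Poincaré inequality (`…GibbsPoincare.stub_gibbsPoincare`)
and the Dirichlet-form bound `∫ |∇W_w|² dμ_T ≲ (∑_k w_k²) Z` (the `RampCorrector` estimates, here with a free
sum-of-squares budget) give `Var(W_w) ≲ ℓ² (N - k₁) Z`, resp. `ℓ² k₂ Z`.

* `saturationEnvelope` — `∃ C ∀ N, k₁ ≤ k₂, k₂ + 1 ≤ N, τ ≥ 0: V_B(τ) ≤ C ℓ² (ℓ + min(k₁, N - k₂)) Z`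
  (uniform in the window: the windowed transport saturates at the static size of the cheaper plateau);
* `lateWindows` — the crux inequality `V_B(τ) ≤ C (1+τ) ℓ Z` on every LATE window
  `ℓ (ℓ + min(k₁, N - k₂)) ≤ 1 + τ`, uniformly in `N`.

Together with `…Partial.shortWindows` (`τ ≤ 1`), `…Partial.boundedBlocks` (`ℓ ≤ ℓ₀`) and `…SharpEnvelope.sharpEnvelope`
(`V_B ≤ C ℓ (1+τ) min(ℓ,τ) Z`) this leaves open exactly the band `1 < τ`, `1 + τ < ℓ (ℓ + min(k₁, N - k₂))` for long
blocks — the `N`-uniform dynamical content of E2 (registered stub `stub_correctorFamily`, crux-equivalent by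
`…CorrectorEquivalence.subBallisticWindow_iff_correctorFamily`).  Nothing here closes the item.
-/

noncomputable section

namespace Summit.AtomisticToContinuum.FouriersLaw.Theorems.SubBallisticWindow.SaturationEnvelope

open MeasureTheory Filter Topology Set
open scoped NNReal ENNReal ContDiff
open Literature.MathematicalPhysics.KineticTheory.HeatConduction
open Summit.AtomisticToContinuum.FouriersLaw.Theorems.SubBallisticWindow.Negative.ClosedFlow
open Summit.AtomisticToContinuum.FouriersLaw.Theorems.ClosedConeSensitivity.Negative.ZeroFrictionDictionary
open Summit.AtomisticToContinuum.FouriersLaw.Theorems.OddSectorWitness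
open Summit.AtomisticToContinuum.FouriersLaw.Theorems.LightConeBondHeat
open Summit.AtomisticToContinuum.FouriersLaw.Theorems.SubdiffusiveBondHeat
open Summit.AtomisticToContinuum.FouriersLaw.Theorems.SubBallisticWindow.RampCorrector
open Summit.AtomisticToContinuum.FouriersLaw.Theses.OddSectorIrreversibility

/-! ## The plateau weights -/

/-! The RIGHT plateau weight is `w_k = min(k,k₂) ∸ k₁` for `k < N` (truncated to `0` for `k ≥ N`); the LEFT plateau
weight is `w_k = (min(k,k₂) ∸ k₁) - (k₂ - k₁)` (`= -ℓ` left of the block, `0` right of it). Both are written inline. -/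

/-- Discrete gradient of the ramp `min(k,k₂) ∸ k₁` = indicator of the block. (adapted from
`Cruxes/SubBallisticWindow/Disproof.lean`, `blockWeight_succ_sub`) [folklore] -/
theorem ramp_succ_sub (k₁ k₂ k : ℕ) :
    ((min (k + 1) k₂ - k₁ : ℕ) : ℝ) - ((min k k₂ - k₁ : ℕ) : ℝ) = if k₁ ≤ k ∧ k < k₂ then 1 else 0 := by
  split_ifs with h
  · rw [show min (k + 1) k₂ - k₁ = (min k k₂ - k₁) + 1 by omega]; push_cast; ring
  · rw [show min (k + 1) k₂ - k₁ = min k k₂ - k₁ by omega]; ring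

/-- Gradient of the right plateau weight away from the last site. [folklore] -/
theorem rightWeight_succ_sub {N k₁ k₂ k : ℕ} (hk : k + 1 < N) :
    (if k + 1 < N then ((min (k + 1) k₂ - k₁ : ℕ) : ℝ) else 0) - (if k < N then ((min k k₂ - k₁ : ℕ) : ℝ) else 0) =
      if k₁ ≤ k ∧ k < k₂ then 1 else 0 := by
  rw [if_pos hk, if_pos (by omega : k < N)]
  exact ramp_succ_sub k₁ k₂ k

/-- Gradient of the left plateau weight. [folklore] -/
theorem leftWeight_succ_sub (k₁ k₂ k : ℕ) :
    (((min (k + 1) k₂ - k₁ : ℕ) : ℝ) - ((k₂ - k₁ : ℕ) : ℝ)) - (((min k k₂ - k₁ : ℕ) : ℝ) - ((k₂ - k₁ : ℕ) : ℝ)) =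
      if k₁ ≤ k ∧ k < k₂ then 1 else 0 := by
  rw [← ramp_succ_sub k₁ k₂ k]; ring

/-- `|w_k| ≤ ℓ` for the right plateau. [folklore] -/
theorem abs_rightWeight_le {k₁ k₂ : ℕ} (hk : k₁ ≤ k₂) (N k : ℕ) :
    |(if k < N then ((min k k₂ - k₁ : ℕ) : ℝ) else 0)| ≤ (k₂ : ℝ) - k₁ := by
  have hℓ : (0 : ℝ) ≤ (k₂ : ℝ) - k₁ := sub_nonneg.mpr (by exact_mod_cast hk)
  split_ifs
  · rw [abs_of_nonneg (Nat.cast_nonneg _), ← Nat.cast_sub hk]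
    exact_mod_cast (by omega : min k k₂ - k₁ ≤ k₂ - k₁)
  · rw [abs_zero]; exact hℓ

/-- `|w_k| ≤ ℓ` for the left plateau. [folklore] -/
theorem abs_leftWeight_le {k₁ k₂ : ℕ} (hk : k₁ ≤ k₂) (k : ℕ) :
    |((min k k₂ - k₁ : ℕ) : ℝ) - ((k₂ - k₁ : ℕ) : ℝ)| ≤ (k₂ : ℝ) - k₁ := by
  have h1 : ((min k k₂ - k₁ : ℕ) : ℝ) ≤ ((k₂ - k₁ : ℕ) : ℝ) := by exact_mod_cast (by omega : min k k₂ - k₁ ≤ k₂ - k₁)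
  have h0 : (0 : ℝ) ≤ ((min k k₂ - k₁ : ℕ) : ℝ) := Nat.cast_nonneg _
  rw [abs_of_nonpos (by linarith), Nat.cast_sub hk]
  linarith

/-- Support of the right plateau: `(k₁, N)`. [folklore] -/
theorem rightWeight_support {N k₁ k₂ k : ℕ} (h : (if k < N then ((min k k₂ - k₁ : ℕ) : ℝ) else 0) ≠ 0) :
    k₁ < k ∧ k < N := by
  by_contra hcon
  apply h
  split_ifs with hkN
  · have : ¬ k₁ < k := fun h' => hcon ⟨h', hkN⟩
    rw [show min k k₂ - k₁ = 0 by omega]; simp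
  · rfl

/-- Support of the left plateau: `[0, k₂)`. [folklore] -/
theorem leftWeight_support {k₁ k₂ k : ℕ} (hk : k₁ ≤ k₂) (h : ((min k k₂ - k₁ : ℕ) : ℝ) - ((k₂ - k₁ : ℕ) : ℝ) ≠ 0) :
    k < k₂ := by
  by_contra hcon
  apply h
  rw [show min k k₂ - k₁ = k₂ - k₁ by omega]; ring

/-- `∑_{i<N} w_i² ≤ L² b` for weights bounded by `L` and supported in `[0, b)`. (adapted from
`…RampCorrector.sum_sq_le`) [folklore] -/
theorem sum_sq_le_of_lt {N b : ℕ} {w : ℕ → ℝ} {L : ℝ} (hw : ∀ k, |w k| ≤ L) (hs : ∀ k, w k ≠ 0 → k < b) :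
    ∑ i : Fin N, (w i.val) ^ 2 ≤ L ^ 2 * (b : ℝ) := by
  set S := (Finset.univ : Finset (Fin N)).filter (fun i => i.val < b) with hS
  have hcard : (S.card : ℝ) ≤ (b : ℝ) := by
    rw [← Finset.card_range b]
    exact_mod_cast Finset.card_le_card_of_injOn (fun i : Fin N => i.val) (fun i hi => by
      simp only [hS, Finset.coe_filter, Finset.mem_univ, true_and, Set.mem_setOf_eq] at hi
      simpa using hi) Fin.val_injective.injOn
  calc ∑ i : Fin N, (w i.val) ^ 2 ≤ ∑ i : Fin N, L ^ 2 * (if i.val < b then 1 else 0) :=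
        Finset.sum_le_sum fun i _ => by
          split_ifs with h
          · rw [mul_one, ← sq_abs]; exact pow_le_pow_left₀ (abs_nonneg _) (hw _) 2
          · rw [show w i.val = 0 from not_not.mp fun hne => h (hs _ hne)]; simp
    _ = L ^ 2 * S.card := by rw [← Finset.mul_sum, Finset.sum_boole]
    _ ≤ _ := mul_le_mul_of_nonneg_left hcard (sq_nonneg _)

section Estimates

variable {ω₂ lam β : ℝ} {N : ℕ} (hω : 0 < ω₂) (hl : 0 ≤ lam) (hβ : 0 ≤ β) (γ : ℝ) {T : ℝ} (hT : 0 < T)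
include hω hl hβ hT

/-- **Dirichlet-form bound with a free sum-of-squares budget**: `∫ |∇W_w|² dμ ≤ C_W D S Z` whenever
`∑_{i<N} w_i² ≤ S` (`D Z` a common bound of the per-site moments `∫ q_i², ∫ q_i⁶, ∫ p_i²`). (adapted from
`…RampCorrector.gradient_bound`, whose support hypothesis `(a,b)` is replaced by the budget `S`) [folklore] -/
theorem gradient_bound_of_sum_sq {w : ℕ → ℝ} {S : ℝ} (hS : ∑ i : Fin N, (w i.val) ^ 2 ≤ S)
    {D Z : ℝ} (hD : 0 ≤ D) (hZ : 0 ≤ Z)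
    (hmo : ∀ i : Fin N, ∫ x, x.1 i ^ 2 ∂(gibbsWeight ω₂ lam β γ N T) ≤ D * Z ∧
      ∫ x, x.1 i ^ 6 ∂(gibbsWeight ω₂ lam β γ N T) ≤ D * Z ∧ ∫ x, x.2 i ^ 2 ∂(gibbsWeight ω₂ lam β γ N T) ≤ D * Z) :
    Integrable (fun x => ∑ i : Fin N, ((partialQ i (weightedEnergy (pinnedChain ω₂ lam β γ) w N) x) ^ 2 +
        (partialP i (weightedEnergy (pinnedChain ω₂ lam β γ) w N) x) ^ 2)) (gibbsWeight ω₂ lam β γ N T) ∧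
    ∫ x, (∑ i : Fin N, ((partialQ i (weightedEnergy (pinnedChain ω₂ lam β γ) w N) x) ^ 2 +
        (partialP i (weightedEnergy (pinnedChain ω₂ lam β γ) w N) x) ^ 2)) ∂(gibbsWeight ω₂ lam β γ N T) ≤
      ((6 * ω₂ ^ 2 + 6 * lam ^ 2 + 1) + 4 * (12 + 192 * β ^ 2)) * (3 * D) * S * Z := by
  set μ := gibbsWeight ω₂ lam β γ N T
  set G := weightedEnergy (pinnedChain ω₂ lam β γ) w N with hG
  set g : PhaseSpace N → ℝ := fun x => ∑ i : Fin N, ((partialQ i G x) ^ 2 + (partialP i G x) ^ 2) with hg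
  set m : Fin N → PhaseSpace N → ℝ := fun i x => x.1 i ^ 2 + x.1 i ^ 6 + x.2 i ^ 2 with hm
  set KA : ℝ := 6 * ω₂ ^ 2 + 6 * lam ^ 2 + 1
  set KB : ℝ := 12 + 192 * β ^ 2
  have hS0 : 0 ≤ S := (Finset.sum_nonneg fun i _ => sq_nonneg (w i.val)).trans hS
  have hG2 : ContDiff ℝ 2 G := contDiff_weightedEnergy _ (pinnedChain_contDiff_U ω₂ lam β γ) (pinnedChain_contDiff_V ω₂ lam β γ) w N
  have hmI : ∀ i, Integrable (m i) μ ∧ ∫ x, m i x ∂μ ≤ 3 * D * Z := fun i => by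
    obtain ⟨h2, h6, hp⟩ := integrable_monomials hω hl hβ γ hT i
    refine ⟨(h2.fun_add h6).fun_add hp, ?_⟩
    simp only [hm]; rw [integral_add (h2.fun_add h6) hp, integral_add h2 h6]
    linarith [(hmo i).1, (hmo i).2.1, (hmo i).2.2]
  have hR1 : Integrable (fun x => ∑ i : Fin N, (w i.val) ^ 2 * m i x) μ := integrable_finsetSum _ fun i _ => (hmI i).1.const_mul _
  have hR2 : Integrable (fun x => ∑ k : Fin N, ∑ l : Fin N,
      (if l.val = k.val + 1 then (w l.val) ^ 2 + (w k.val) ^ 2 else 0) * (m k x + m l x)) μ :=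
    integrable_finsetSum _ fun k _ => integrable_finsetSum _ fun l _ => ((hmI k).1.fun_add (hmI l).1).const_mul _
  have hpt : ∀ x, g x ≤ KA * (∑ i : Fin N, (w i.val) ^ 2 * m i x) +
      KB * ∑ k : Fin N, ∑ l : Fin N, (if l.val = k.val + 1 then (w l.val) ^ 2 + (w k.val) ^ 2 else 0) * (m k x + m l x) := by
    intro x
    simp only [hg, hG, hm, partialQ_weightedEnergy _ ((pinnedChain_contDiff_U ω₂ lam β γ (n := 1)).differentiable one_ne_zero)
      ((pinnedChain_contDiff_V ω₂ lam β γ (n := 1)).differentiable one_ne_zero), partialP_weightedEnergy]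
    exact gradSq_le γ w x
  have hRint := (hR1.const_mul KA).fun_add (hR2.const_mul KB)
  have hint : Integrable g μ := hRint.mono'
    (continuous_finsetSum _ fun i _ => ((continuous_partialQ hG2 two_ne_zero i).pow 2).add
      ((continuous_partialP hG2 two_ne_zero i).pow 2)).aestronglyMeasurable
    (Eventually.of_forall fun x => by
      rw [Real.norm_eq_abs, abs_of_nonneg (Finset.sum_nonneg fun i _ => by positivity)]; exact hpt x)
  refine ⟨hint, (integral_mono hint hRint hpt).trans ?_⟩
  rw [integral_add (hR1.const_mul KA) (hR2.const_mul KB), integral_const_mul, integral_const_mul,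
    integral_finsetSum _ fun i _ => (hmI i).1.const_mul _,
    integral_finsetSum _ fun k _ => integrable_finsetSum _ fun l _ => ((hmI k).1.fun_add (hmI l).1).const_mul _]
  have I1 : ∑ i : Fin N, ∫ x, (w i.val) ^ 2 * m i x ∂μ ≤ S * (3 * D * Z) :=
    calc ∑ i : Fin N, ∫ x, (w i.val) ^ 2 * m i x ∂μ ≤ ∑ i : Fin N, (w i.val) ^ 2 * (3 * D * Z) :=
          Finset.sum_le_sum fun i _ => by
            rw [integral_const_mul]; exact mul_le_mul_of_nonneg_left (hmI i).2 (sq_nonneg _)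
      _ ≤ _ := by rw [← Finset.sum_mul]; exact mul_le_mul_of_nonneg_right hS (by positivity)
  have I2 : ∑ k : Fin N, ∫ x, ∑ l : Fin N, (if l.val = k.val + 1 then (w l.val) ^ 2 + (w k.val) ^ 2 else 0) *
      (m k x + m l x) ∂μ ≤ (2 * S) * (2 * (3 * D * Z)) :=
    calc _ ≤ ∑ k : Fin N, ∑ l : Fin N, (if l.val = k.val + 1 then (w l.val) ^ 2 + (w k.val) ^ 2 else 0) *
          (2 * (3 * D * Z)) := by
          refine Finset.sum_le_sum fun k _ => ?_
          rw [integral_finsetSum _ fun l _ => ((hmI k).1.fun_add (hmI l).1).const_mul _]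
          refine Finset.sum_le_sum fun l _ => ?_
          rw [integral_const_mul, integral_add (hmI k).1 (hmI l).1]
          exact mul_le_mul_of_nonneg_left (by linarith [(hmI k).2, (hmI l).2]) (by split_ifs <;> positivity)
      _ = (∑ k : Fin N, ∑ l : Fin N, (if l.val = k.val + 1 then (w l.val) ^ 2 + (w k.val) ^ 2 else 0)) *
          (2 * (3 * D * Z)) := by
          rw [Finset.sum_mul]; exact Finset.sum_congr rfl fun k _ => (Finset.sum_mul _ _ _).symm
      _ ≤ _ := mul_le_mul_of_nonneg_right ((sum_bond_ends_le N (f := fun i : Fin N => (w i.val) ^ 2)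
          fun i => sq_nonneg _).trans (mul_le_mul_of_nonneg_left hS (by norm_num))) (by positivity)
  nlinarith [mul_le_mul_of_nonneg_left I1 (by positivity : (0 : ℝ) ≤ KA), mul_le_mul_of_nonneg_left I2 (by positivity : (0 : ℝ) ≤ KB)]

omit hω hl hβ hT in
/-- `{H, W_w} = J_B` EXACTLY for the right plateau (its jump at the last site multiplies `j_{N-1} ≡ 0`). [folklore] -/
theorem poisson_rightWeight (k₁ k₂ : ℕ) (x : PhaseSpace N) :
    poisson ((pinnedChain ω₂ lam β γ).hamiltonian N)
      (weightedEnergy (pinnedChain ω₂ lam β γ) (fun k => if k < N then ((min k k₂ - k₁ : ℕ) : ℝ) else 0) N) x =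
      blockCurrent ω₂ lam β γ N k₁ k₂ x := by
  unfold blockCurrent
  rw [poisson_hamiltonian_weightedEnergy _ ((pinnedChain_contDiff_U ω₂ lam β γ (n := 1)).differentiable one_ne_zero)
    ((pinnedChain_contDiff_V ω₂ lam β γ (n := 1)).differentiable one_ne_zero)]
  refine Finset.sum_congr rfl fun i _ => ?_
  rcases Nat.lt_or_ge (i.val + 1) N with hi | hi
  · rw [rightWeight_succ_sub hi]
    split_ifs <;> ring
  · have hlast : i.val + 1 = N := le_antisymm i.isLt hi
    rw [OscillatorChain.bondCurrent_eq_zero_of_last _ N i hlast x]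
    split_ifs <;> ring

omit hω hl hβ hT in
/-- `{H, W_w} = J_B` EXACTLY for the left plateau. [folklore] -/
theorem poisson_leftWeight (k₁ k₂ : ℕ) (x : PhaseSpace N) :
    poisson ((pinnedChain ω₂ lam β γ).hamiltonian N)
      (weightedEnergy (pinnedChain ω₂ lam β γ) (fun k => ((min k k₂ - k₁ : ℕ) : ℝ) - ((k₂ - k₁ : ℕ) : ℝ)) N) x =
      blockCurrent ω₂ lam β γ N k₁ k₂ x := by
  unfold blockCurrent
  rw [poisson_hamiltonian_weightedEnergy _ ((pinnedChain_contDiff_U ω₂ lam β γ (n := 1)).differentiable one_ne_zero)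
    ((pinnedChain_contDiff_V ω₂ lam β γ (n := 1)).differentiable one_ne_zero)]
  refine Finset.sum_congr rfl fun i _ => ?_
  rw [leftWeight_succ_sub]
  split_ifs <;> ring

/-- **Plateau correctors** (`window`/`gibbsWeight` vocabulary). Given the Poincaré inequality for `μ` and an
`N`-uniform bound `D Z` on the moments `∫ q_i², ∫ q_i⁶, ∫ p_i²`: for every block `k₁ ≤ k₂` with `k₂ + 1 ≤ N`, every
window `τ ≥ 0` and every weight `w` with `{H, W_w} = J_B`, `|w_k| ≤ ℓ`-type bound `L` and budget `∑ w_i² ≤ S`,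
`V_B(τ) ≤ 8 (T / min(ω₂,1)) C_W (3D) S Z`. [folklore] -/
theorem window_sq_le_of_exact_corrector
    (hP : ∀ (G : PhaseSpace N → ℝ), ContDiff ℝ 1 G → MemLp G 2 (gibbsWeight ω₂ lam β γ N T) →
      Integrable (fun x : PhaseSpace N => ∑ i : Fin N, ((partialQ i G x) ^ 2 + (partialP i G x) ^ 2))
        (gibbsWeight ω₂ lam β γ N T) →
      ∫ x, (G x - (∫ y, G y ∂(gibbsWeight ω₂ lam β γ N T)) /
          (∫ x : PhaseSpace N, Real.exp (-((pinnedChain ω₂ lam β γ).hamiltonian N x) / T))) ^ 2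
        ∂(gibbsWeight ω₂ lam β γ N T) ≤
        T / min ω₂ 1 * ∫ x, (∑ i : Fin N, ((partialQ i G x) ^ 2 + (partialP i G x) ^ 2)) ∂(gibbsWeight ω₂ lam β γ N T))
    {D : ℝ} (hD : 0 ≤ D)
    (hmo : ∀ i : Fin N, ∫ x, x.1 i ^ 2 ∂(gibbsWeight ω₂ lam β γ N T) ≤
        D * ∫ x : PhaseSpace N, Real.exp (-((pinnedChain ω₂ lam β γ).hamiltonian N x) / T) ∧
      ∫ x, x.1 i ^ 6 ∂(gibbsWeight ω₂ lam β γ N T) ≤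
        D * ∫ x : PhaseSpace N, Real.exp (-((pinnedChain ω₂ lam β γ).hamiltonian N x) / T) ∧
      ∫ x, x.2 i ^ 2 ∂(gibbsWeight ω₂ lam β γ N T) ≤
        D * ∫ x : PhaseSpace N, Real.exp (-((pinnedChain ω₂ lam β γ).hamiltonian N x) / T))
    (k₁ k₂ : ℕ) {τ : ℝ} (hτ : 0 ≤ τ) {w : ℕ → ℝ} {L S : ℝ} (hL : 0 ≤ L) (hw : ∀ k, |w k| ≤ L)
    (hS : ∑ i : Fin N, (w i.val) ^ 2 ≤ S)
    (hexact : ∀ x, poisson ((pinnedChain ω₂ lam β γ).hamiltonian N)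
      (weightedEnergy (pinnedChain ω₂ lam β γ) w N) x = blockCurrent ω₂ lam β γ N k₁ k₂ x) :
    ∫ x, (window ω₂ lam β γ N k₁ k₂ τ x) ^ 2 ∂(gibbsWeight ω₂ lam β γ N T) ≤
      8 * (T / min ω₂ 1) * (((6 * ω₂ ^ 2 + 6 * lam ^ 2 + 1) + 4 * (12 + 192 * β ^ 2)) * (3 * D)) * S *
        ∫ x : PhaseSpace N, Real.exp (-((pinnedChain ω₂ lam β γ).hamiltonian N x) / T) := by
  set μ := gibbsWeight ω₂ lam β γ N T with hμ
  set Z : ℝ := ∫ x : PhaseSpace N, Real.exp (-((pinnedChain ω₂ lam β γ).hamiltonian N x) / T) with hZ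
  have hZ0 : 0 ≤ Z := integral_nonneg fun x => (Real.exp_pos _).le
  have hK0 : 0 ≤ T / min ω₂ 1 := div_nonneg hT.le (le_min hω.le zero_le_one)
  set CE : ℝ := ((6 * ω₂ ^ 2 + 6 * lam ^ 2 + 1) + 4 * (12 + 192 * β ^ 2)) * (3 * D) with hCE
  obtain ⟨hInt, hgrad⟩ := gradient_bound_of_sum_sq hω hl hβ γ hT hS hD hZ0 hmo
  set G := weightedEnergy (pinnedChain ω₂ lam β γ) w N with hG
  have hG2 : ContDiff ℝ 2 G := contDiff_weightedEnergy _ (pinnedChain_contDiff_U ω₂ lam β γ) (pinnedChain_contDiff_V ω₂ lam β γ) w N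
  have hGL2 : MemLp G 2 μ := memLp_two_of_abs_le_pow hω hl hβ γ N hT hG2.continuous.aestronglyMeasurable L 1 fun x => by
    have h := abs_weightedEnergy_le hω.le hl hβ γ hw x
    nlinarith [pinnedChain_hamiltonian_nonneg hω.le hl hβ γ N x, hL]
  have hPo : poisson ((pinnedChain ω₂ lam β γ).hamiltonian N) G = blockCurrent ω₂ lam β γ N k₁ k₂ := funext hexact
  have hPL2 : MemLp (poisson ((pinnedChain ω₂ lam β γ).hamiltonian N) G) 2 μ := by
    rw [hPo]; exact memLp_blockCurrent hω hl hβ γ hT k₁ k₂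
  have h1 := CoboundaryCeiling.integral_window_sq_le hω hl hβ γ N k₁ k₂ hT hτ ((∫ y, G y ∂μ) / Z) hG2 hGL2 hPL2
  have hdef : ∫ x, (blockCurrent ω₂ lam β γ N k₁ k₂ x - poisson ((pinnedChain ω₂ lam β γ).hamiltonian N) G x) ^ 2 ∂μ = 0 := by
    simp [hPo]
  rw [hdef, mul_zero, add_zero] at h1
  have hvar : ∫ x, (G x - (∫ y, G y ∂μ) / Z) ^ 2 ∂μ ≤ (T / min ω₂ 1) * (CE * S * Z) :=
    (hP G (hG2.of_le (by norm_num)) hGL2 hInt).trans (mul_le_mul_of_nonneg_left hgrad hK0)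
  calc ∫ x, (window ω₂ lam β γ N k₁ k₂ τ x) ^ 2 ∂μ ≤ 8 * ∫ x, (G x - (∫ y, G y ∂μ) / Z) ^ 2 ∂μ := h1
    _ ≤ 8 * ((T / min ω₂ 1) * (CE * S * Z)) := mul_le_mul_of_nonneg_left hvar (by norm_num)
    _ = 8 * (T / min ω₂ 1) * CE * S * Z := by ring

end Estimates

/-! ## Headline theorems in the crux's vocabulary -/

/-- **Saturation envelope** (`N`-uniform, uniform in the window). For `ω₂ > 0`, `lam, β ≥ 0`, any `γ`, `T > 0`
there is `C` with, for every `N`, block `[k₁,k₂)` (`k₂ + 1 ≤ N`) and EVERY window `τ ≥ 0`,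
`∫ (∫_{(0,τ]} (P⁰_t J_B)(x) dt)² e^{-H(x)/T} dx ≤ C (k₂-k₁)² ((k₂-k₁) + min(k₁, N-k₂)) Z`: the windowed block transport
of the closed chain never exceeds the static size of the cheaper of the two plateau energies `∑_k w_k h_k` whose
Liouville derivative is EXACTLY `J_B` (Thomson inequality with zero defect + Poincaré + Gibbs moments). [folklore] -/
theorem saturationEnvelope :
    ∀ ω₂ lam β γ : ℝ, 0 < ω₂ → 0 ≤ lam → 0 ≤ β → ∀ T : ℝ, 0 < T → ∃ C : ℝ, ∀ (N k₁ k₂ : ℕ), k₁ ≤ k₂ →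
      k₂ + 1 ≤ N → ∀ τ : ℝ, 0 ≤ τ →
      let P := pinnedChain ω₂ lam β γ;
      let P₀ := pinnedChain ω₂ lam β 0;
      let μT : Measure (PhaseSpace N) :=
        volume.withDensity (fun x : PhaseSpace N => ENNReal.ofReal (Real.exp (-(P.hamiltonian N x) / T)));
      let JB : PhaseSpace N → ℝ := fun z => ∑ i : Fin N,
        (if k₁ ≤ i.val ∧ i.val < k₂ then P.bondCurrent N i z else 0);
      ∫ x, (∫ t in Set.Ioc (0 : ℝ) τ, (∫ y, JB y ∂(P₀.transitionKernel N T T t.toNNReal x))) ^ 2 ∂μT ≤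
        C * ((k₂ : ℝ) - k₁) ^ 2 * (((k₂ : ℝ) - k₁) + min (k₁ : ℝ) ((N : ℝ) - k₂)) *
          ∫ x, Real.exp (-(P.hamiltonian N x) / T) ∂volume := by
  intro ω₂ lam β γ hω hl hβ T hT
  -- the landed statics of line `Sketch`
  have hP := GibbsPoincare.stub_gibbsPoincare ω₂ lam β γ hω hl hβ T hT
  have hM := GibbsMoments.stub_gibbsMoments ω₂ lam β γ hω hl hβ T hT hP
  obtain ⟨C₁, hC₁⟩ := hM 1
  obtain ⟨C₃, hC₃⟩ := hM 3
  simp only [mul_one] at hC₁; simp only [Nat.reduceMul] at hC₃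
  set D := max (max C₁ C₃) 0 with hD
  have hD0 : 0 ≤ D := le_max_right _ _
  have hK0 : 0 ≤ T / min ω₂ 1 := div_nonneg hT.le (le_min hω.le zero_le_one)
  set CE : ℝ := ((6 * ω₂ ^ 2 + 6 * lam ^ 2 + 1) + 4 * (12 + 192 * β ^ 2)) * (3 * D) with hCE
  have hCE0 : 0 ≤ CE := by positivity
  refine ⟨8 * (T / min ω₂ 1) * CE, fun N k₁ k₂ hk hkN τ hτ => ?_⟩
  simp only
  set Z := ∫ y, Real.exp (-((pinnedChain ω₂ lam β γ).hamiltonian N y) / T) ∂volume with hZ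
  have hZ0 : 0 ≤ Z := integral_nonneg fun _ => (Real.exp_pos _).le
  have hℓ0 : (0 : ℝ) ≤ (k₂ : ℝ) - k₁ := sub_nonneg.mpr (by exact_mod_cast hk)
  have hdict := Partial.integral_window_kernel_eq hω hl hβ γ N k₁ k₂ T τ (gibbsWeight ω₂ lam β γ N T)
  simp only [blockCurrent] at hdict
  rw [show (volume.withDensity fun x : PhaseSpace N =>
      ENNReal.ofReal (Real.exp (-((pinnedChain ω₂ lam β γ).hamiltonian N x) / T))) =
      gibbsWeight ω₂ lam β γ N T from rfl, hdict]
  have hmo : ∀ i : Fin N, ∫ x, x.1 i ^ 2 ∂(gibbsWeight ω₂ lam β γ N T) ≤ D * Z ∧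
      ∫ x, x.1 i ^ 6 ∂(gibbsWeight ω₂ lam β γ N T) ≤ D * Z ∧ ∫ x, x.2 i ^ 2 ∂(gibbsWeight ω₂ lam β γ N T) ≤ D * Z :=
    fun i => ⟨(hC₁ N i).1.trans (mul_le_mul_of_nonneg_right (le_max_of_le_left (le_max_left _ _)) hZ0),
      (hC₃ N i).1.trans (mul_le_mul_of_nonneg_right (le_max_of_le_left (le_max_right _ _)) hZ0),
      (hC₁ N i).2.trans (mul_le_mul_of_nonneg_right (le_max_of_le_left (le_max_left _ _)) hZ0)⟩
  -- the two plateau correctors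
  have hR := window_sq_le_of_exact_corrector hω hl hβ γ hT (hP N) hD0 hmo k₁ k₂ hτ hℓ0 (abs_rightWeight_le hk N)
    (sum_sq_le (N := N) (show k₁ ≤ N by omega) (abs_rightWeight_le hk N) fun k h => rightWeight_support h)
    (poisson_rightWeight γ k₁ k₂)
  have hL := window_sq_le_of_exact_corrector hω hl hβ γ hT (hP N) hD0 hmo k₁ k₂ hτ hℓ0 (abs_leftWeight_le hk)
    (sum_sq_le_of_lt (N := N) (abs_leftWeight_le hk) fun k h => leftWeight_support hk h)
    (poisson_leftWeight γ k₁ k₂)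
  have hwin : ∫ x, (∫ t in Ioc (0 : ℝ) τ, blockCurrent ω₂ lam β γ N k₁ k₂ (detFlow ω₂ lam β N t x)) ^ 2
      ∂(gibbsWeight ω₂ lam β γ N T) = ∫ x, (window ω₂ lam β γ N k₁ k₂ τ x) ^ 2 ∂(gibbsWeight ω₂ lam β γ N T) := rfl
  simp only [blockCurrent] at hwin
  rw [hwin]
  -- `min(N - k₁, k₂) = ℓ + min(k₁, N - k₂)`
  have hmin : min (((N : ℝ) - k₁)) (k₂ : ℝ) = ((k₂ : ℝ) - k₁) + min (k₁ : ℝ) ((N : ℝ) - k₂) := by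
    have h1 : min ((N : ℝ) - k₁) (k₂ : ℝ) = min (((k₂ : ℝ) - k₁) + ((N : ℝ) - k₂)) (((k₂ : ℝ) - k₁) + k₁) := by
      congr 1 <;> ring
    rw [h1, min_add_add_left]
    congr 1
    exact min_comm _ _
  rw [← hmin]
  rcases le_total ((N : ℝ) - k₁) (k₂ : ℝ) with hcase | hcase
  · rw [min_eq_left hcase]
    calc _ ≤ 8 * (T / min ω₂ 1) * CE * (((k₂ : ℝ) - k₁) ^ 2 * ((N : ℝ) - k₁)) * Z := hR
      _ = _ := by ring
  · rw [min_eq_right hcase]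
    calc _ ≤ 8 * (T / min ω₂ 1) * CE * (((k₂ : ℝ) - k₁) ^ 2 * (k₂ : ℝ)) * Z := hL
      _ = _ := by ring

/-- **E2 on late windows** (`N`-uniform). For `ω₂ > 0`, `lam, β ≥ 0`, any `γ`, `T > 0` there is `C` with, for every
`N`, block `[k₁,k₂)` (`k₂ + 1 ≤ N`, `ℓ = k₂ - k₁`) and every window `τ ≥ 0` with `ℓ (ℓ + min(k₁, N - k₂)) ≤ 1 + τ`,
`∫ (∫_{(0,τ]} (P⁰_t J_B)(x) dt)² e^{-H(x)/T} dx ≤ C (1 + τ) (k₂ - k₁) Z` — the crux inequality beyond the saturation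
time of the cheaper plateau (from `saturationEnvelope`). [folklore] -/
theorem lateWindows :
    ∀ ω₂ lam β γ : ℝ, 0 < ω₂ → 0 ≤ lam → 0 ≤ β → ∀ T : ℝ, 0 < T → ∃ C : ℝ, ∀ (N k₁ k₂ : ℕ), k₁ ≤ k₂ →
      k₂ + 1 ≤ N → ∀ τ : ℝ, 0 ≤ τ → ((k₂ : ℝ) - k₁) * (((k₂ : ℝ) - k₁) + min (k₁ : ℝ) ((N : ℝ) - k₂)) ≤ 1 + τ →
      let P := pinnedChain ω₂ lam β γ;
      let P₀ := pinnedChain ω₂ lam β 0;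
      let μT : Measure (PhaseSpace N) :=
        volume.withDensity (fun x : PhaseSpace N => ENNReal.ofReal (Real.exp (-(P.hamiltonian N x) / T)));
      let JB : PhaseSpace N → ℝ := fun z => ∑ i : Fin N,
        (if k₁ ≤ i.val ∧ i.val < k₂ then P.bondCurrent N i z else 0);
      ∫ x, (∫ t in Set.Ioc (0 : ℝ) τ, (∫ y, JB y ∂(P₀.transitionKernel N T T t.toNNReal x))) ^ 2 ∂μT ≤
        C * (1 + τ) * ((k₂ : ℝ) - k₁) * ∫ x, Real.exp (-(P.hamiltonian N x) / T) ∂volume := by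
  intro ω₂ lam β γ hω hl hβ T hT
  obtain ⟨C, hC⟩ := saturationEnvelope ω₂ lam β γ hω hl hβ T hT
  refine ⟨max C 0, fun N k₁ k₂ hk hkN τ hτ hlate => ?_⟩
  have h1 := hC N k₁ k₂ hk hkN τ hτ
  simp only at h1 ⊢
  refine h1.trans ?_
  set Z := ∫ y, Real.exp (-((pinnedChain ω₂ lam β γ).hamiltonian N y) / T) ∂volume with hZ
  have hZ0 : 0 ≤ Z := integral_nonneg fun _ => (Real.exp_pos _).le
  have hℓ0 : (0 : ℝ) ≤ (k₂ : ℝ) - k₁ := sub_nonneg.mpr (by exact_mod_cast hk)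
  have hd0 : 0 ≤ min (k₁ : ℝ) ((N : ℝ) - k₂) := by
    refine le_min (Nat.cast_nonneg _) ?_
    have : (k₂ : ℝ) + 1 ≤ N := by exact_mod_cast hkN
    linarith
  have hkey : ((k₂ : ℝ) - k₁) ^ 2 * (((k₂ : ℝ) - k₁) + min (k₁ : ℝ) ((N : ℝ) - k₂)) ≤ (1 + τ) * ((k₂ : ℝ) - k₁) := by
    calc ((k₂ : ℝ) - k₁) ^ 2 * (((k₂ : ℝ) - k₁) + min (k₁ : ℝ) ((N : ℝ) - k₂))
        = (((k₂ : ℝ) - k₁) * (((k₂ : ℝ) - k₁) + min (k₁ : ℝ) ((N : ℝ) - k₂))) * ((k₂ : ℝ) - k₁) := by ring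
      _ ≤ (1 + τ) * ((k₂ : ℝ) - k₁) := mul_le_mul_of_nonneg_right hlate hℓ0
  calc C * ((k₂ : ℝ) - k₁) ^ 2 * (((k₂ : ℝ) - k₁) + min (k₁ : ℝ) ((N : ℝ) - k₂)) * Z
      = C * ((((k₂ : ℝ) - k₁) ^ 2 * (((k₂ : ℝ) - k₁) + min (k₁ : ℝ) ((N : ℝ) - k₂))) * Z) := by ring
    _ ≤ max C 0 * ((((k₂ : ℝ) - k₁) ^ 2 * (((k₂ : ℝ) - k₁) + min (k₁ : ℝ) ((N : ℝ) - k₂))) * Z) :=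
        mul_le_mul_of_nonneg_right (le_max_left _ _) (by positivity)
    _ ≤ max C 0 * (((1 + τ) * ((k₂ : ℝ) - k₁)) * Z) :=
        mul_le_mul_of_nonneg_left (mul_le_mul_of_nonneg_right hkey hZ0) (le_max_right _ _)
    _ = max C 0 * (1 + τ) * ((k₂ : ℝ) - k₁) * Z := by ring

end Summit.AtomisticToContinuum.FouriersLaw.Theorems.SubBallisticWindow.SaturationEnvelope

end
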